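import Summits.Ventures.YMGap.RobustBall.LangevinPoincareDLR
import Summits.Ventures.YMGap.Thresholds.OneLinkModulusSU3Twisted
import Literature.MathematicalPhysics.QuantumFieldTheory.Balaban1983to89.StrongCouplingKernelWindow
import HarnessLib

/-!
# Robust ball (Y2) — the Langevin Poincaré inequality of every Gibbs state: every-`SU(N)` (Bakry–Émery modulus) and `SU(3)` (twisted modulus) cells

HONEST FRAMING: venture file of the cell `pub-ymgap` (QuantumFields programme), track ROBUST-BALL, seat rb-p2 (g14); cells of
`LangevinPoincareDLR.gibbs_variance_le_integral_Gam_of_oneLinkKRModulus` (the gradient-form Poincaré inequality of EVERY DLR state of the Wilson specification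
on `ℤ⁴`).  LATTICE statements at STRONG COUPLING, Wilson action (class K); nothing about `β → ∞`, the continuum or Clay.
* `suN_gibbs_variance_le_integral_Gam_bakryEmery` — EVERY `SU(N)`, `N ≥ 2`, `d = 4`, HYPOTHESIS-FREE on Shen–Zhu–Zhu's printed window 't Hooft `0 ≤ b < 1/48` (bare `Nb`;
  Bakry–Émery one-link modulus `K = 1/(1/2 − 6b)`): for EVERY DLR state `μ` and every smooth `f` of finitely many link matrices,
  `Var_μ(F) ≤ (N(1/2 − 24b))⁻¹ ∫ Γ(f,f) dμ` — no window gain over Bakry–Émery for general `N` (the gain is `SU(2)`'s quarter modulus), but the Gibbs-state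
  (not only torus-limit) form is new;
* `su3_gibbs_variance_le_integral_Gam_pv2t` — `SU(3)`, `d = 4`, engine-2's certified TWISTED modulus `OneLinkKRModulus 3 (1/5) (3531/2000)`: on `0 ≤ β_W < 1000/3531`
  (tree coupling `β_W/3`), `Var_μ(F) ≤ ((1 − 3531β_W/1000)(3/2 − 2β_W))⁻¹ ∫ Γ(f,f) dμ` for every DLR state (Bakry–Émery: `β_W < 9/32`).
0 sorry, 0 definitions.  Everything here is proved. [folklore]
-/

noncomputable section

open scoped Matrix ComplexConjugate BigOperators Matrix.Norms.Frobenius ContDiff Topology ProbabilityTheory NNReal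
open Matrix Complex Finset MeasureTheory Filter ProbabilityTheory Function Real
open Literature.Probability.LatticeModels Literature.Probability.LatticeModels.DobrushinMetric
open Literature.MathematicalPhysics.QuantumLattice hiding torusNorm
open Literature.MathematicalPhysics.QuantumFieldTheory hiding ZdEdge
open Literature.MathematicalPhysics.QuantumFieldTheory.SUNBakryEmery (SUN FrameIdx frame haarSU pot)
open Literature.MathematicalPhysics.QuantumFieldTheory.Balaban1983to89.StrongCouplingDobrushinWindow (OneLinkKRModulus)
open Summit.Ventures.YMGap.LatticeBakryEmery

namespace Summit.Ventures.YMGap.RobustBall.LangevinPoincare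

variable {N : ℕ}

/-- **EVERY `SU(N)`, `N ≥ 2`, `d = 4`, HYPOTHESIS-FREE on 't Hooft `0 ≤ b < 1/48`** (bare `Nb`; Bakry–Émery one-link modulus): for every DLR state `μ` and every smooth
`f` of the link matrices over a finite `Δ`, `Var_μ(f((U_e)_{e∈Δ})) ≤ (N(1/2 − 24b))⁻¹ ∫ Γ(f,f) dμ`. [folklore] -/
theorem suN_gibbs_variance_le_integral_Gam_bakryEmery (hN : 2 ≤ N) {b : ℝ} (hb0 : 0 ≤ b) (hb : b < 1 / 48)
    {μ : Measure (LGConfig 4 (SUN N))} (hμ : μ ∈ ymGibbsMeasures (d := 4) (fundamentalRep (Fin N)) ((N : ℝ) * b))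
    (Δ : Finset (ZdEdge 4)) {f : Cfg ↥Δ N → ℝ} (hf : ContDiff ℝ ∞ f) :
    Var[matrixCylinder Δ f; μ] ≤ ((N : ℝ) * (1 / 2 - 24 * b))⁻¹ * ∫ U, Gam f f (fun e : ↥Δ => (U e : Matrix (Fin N) (Fin N) ℂ)) ∂μ := by
  have hN0 : (0 : ℝ) < N := by exact_mod_cast (show 0 < N by omega)
  have habs : |b| = b := abs_of_nonneg hb0
  have hden : 0 < 1 / 2 - 6 * b := by linarith
  have hc1 : 18 * b / (1 / 2 - 6 * b) < 1 := by rw [div_lt_one hden]; linarith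
  have hK₀ : 0 < (N : ℝ) / 2 - N * |b| * (2 * (((4 : ℕ) : ℝ) - 1)) := by rw [habs]; push_cast; nlinarith
  have key := gibbs_variance_le_integral_Gam_of_oneLinkKRModulus (d := 4) (N := N) (by norm_num) (by omega) (β := b) (K := 1 / (1 / 2 - 6 * b))
    (by positivity) (R := 6 * b) (by rw [habs]; push_cast; linarith) (Balaban1983to89.StrongCouplingKernelWindow.oneLinkKRModulus_SU hN (by linarith))
    (c := 18 * b / (1 / 2 - 6 * b)) (by rw [habs]; push_cast; exact le_of_eq (by field_simp; ring)) hc1 hK₀ hμ Δ hf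
  have e : (1 - 18 * b / (1 / 2 - 6 * b)) * ((N : ℝ) / 2 - N * |b| * (2 * (((4 : ℕ) : ℝ) - 1))) = N * (1 / 2 - 24 * b) := by
    rw [habs]; push_cast
    rw [show (N : ℝ) / 2 - N * b * (2 * (4 - 1)) = N * (1 / 2 - 6 * b) by ring, sub_mul, one_mul, div_mul_eq_mul_div,
      show 18 * b * ((N : ℝ) * (1 / 2 - 6 * b)) = 18 * b * N * (1 / 2 - 6 * b) by ring, mul_div_assoc, div_self hden.ne', mul_one]
    ring
  rw [e] at key
  exact key

/-- ★★ **`SU(3)`, `d = 4`, HYPOTHESIS-FREE (twisted modulus `OneLinkKRModulus 3 (1/5) (3531/2000)`) on `0 ≤ β_W < 1000/3531`** (tree coupling `β_W/3`): for every DLR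
state `μ` and every smooth `f` of the link matrices over a finite `Δ`, `Var_μ(f((U_e)_{e∈Δ})) ≤ ((1 − 3531β_W/1000)(3/2 − 2β_W))⁻¹ ∫ Γ(f,f) dμ`. [folklore] -/
theorem su3_gibbs_variance_le_integral_Gam_pv2t {βW : ℝ} (h0 : 0 ≤ βW) (h : βW < 1000 / 3531)
    {μ : Measure (LGConfig 4 (SUN 3))} (hμ : μ ∈ ymGibbsMeasures (d := 4) (fundamentalRep (Fin 3)) (βW / 3))
    (Δ : Finset (ZdEdge 4)) {f : Cfg ↥Δ 3 → ℝ} (hf : ContDiff ℝ ∞ f) :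
    Var[matrixCylinder Δ f; μ] ≤ ((1 - 3531 * βW / 1000) * (3 / 2 - 2 * βW))⁻¹ * ∫ U, Gam f f (fun e : ↥Δ => (U e : Matrix (Fin 3) (Fin 3) ℂ)) ∂μ := by
  have hβ : ((3 : ℕ) : ℝ) * (βW / 9) = βW / 3 := by push_cast; ring
  have habs : |βW / 9| = βW / 9 := abs_of_nonneg (by positivity)
  have hμ9 : μ ∈ ymGibbsMeasures (d := 4) (fundamentalRep (Fin 3)) (((3 : ℕ) : ℝ) * (βW / 9)) := by rwa [hβ]
  have key := gibbs_variance_le_integral_Gam_of_oneLinkKRModulus (d := 4) (N := 3) (by norm_num) (by norm_num) (β := βW / 9) (by norm_num) (R := 1 / 5)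
    (by rw [habs]; push_cast; linarith) TwistedBochner.su3_oneLinkKRModulus_pv2t_oneFifth (c := 3531 * βW / 1000)
    (by rw [habs]; push_cast; linarith) (by linarith) (by rw [habs]; push_cast; linarith) hμ9 Δ hf
  have e : (1 - 3531 * βW / 1000) * (((3 : ℕ) : ℝ) / 2 - (3 : ℕ) * |βW / 9| * (2 * (((4 : ℕ) : ℝ) - 1))) = (1 - 3531 * βW / 1000) * (3 / 2 - 2 * βW) := by
    rw [habs]; push_cast; ring
  rw [e] at key
  exact key

end Summit.Ventures.YMGap.RobustBall.LangevinPoincare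

end
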